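import Summits.CriticalPhenomena.SAWScalingLimit.Theorems.SAWReversalUpgradeAttachReversalDefs
import Summits.CriticalPhenomena.SAWScalingLimit.Theorems.SAWReversalUpgradeFaithfulOfNoReturnHalfPlane
import Literature.Probability.RandomPlanarGeometry.SchwarzianCapacity
import Literature.Probability.RandomPlanarGeometry.ConformalRectangleProofs

/-!
# Attachment reversal, preliminaries A: the two uniformizers and their boundary extensions

Helper file for item `AttachReversal` of route `SAWReversalUpgrade` (stmt-CriticalPhenomena-18007).
For a Dobrushin domain `(D; a, b)` with chordal uniformizer `φ : ℍ → D` (`φ(0) = a`, `φ(∞) = b`) and a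
chordal uniformizer `φ'` of the swapped domain `D.swap = (D; b, a)`:

* `exists_eqOn_swap` — `φ' z = φ (-1/(c z))` on `ℍ` for some `c > 0` (the inversion `z ↦ -1/z`
  exchanges `0` and `∞`, `IsChordalUniformizing.exists_eq_trans_smul_holds`);
* the inversion `ι_c z = -1/(c z)`: an involution of `ℍ̄ ∖ {0}` of modulus `1/(c|z|)`;
* `bExt_swap_eq` — the boundary extensions satisfy `Φ' z = Φ (ι_c z)` on `ℍ̄ ∖ {0}`,
  `Φ' 0 = b`, `Φ 0 = a`;
* the inverses `ψ = invFunOn Φ ℍ̄`, `ψ' = invFunOn Φ' ℍ̄` satisfy `ψ' = ι_c ∘ ψ` on `D̄ ∖ {a, b}`,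
  `ψ' b = 0` (the basic facts on `Φ`, `ψ` — Carathéodory — are the tree's, file
  `SAWReversalUpgradeFaithfulOfNoReturnHalfPlane`, namespace `FaithfulAttach`).
-/

noncomputable section

open Set Function Filter Topology Complex
open UpperHalfPlane (upperHalfPlaneSet)
open Literature.Probability.RandomPlanarGeometry

namespace Summit.CriticalPhenomena.SAWScalingLimit.Theorems.AttachReversal

/-! ### The inversion `z ↦ -1/(c z)` -/

/-- `-1/(c z)` lies in `ℍ` for `z ∈ ℍ`, `c > 0`. -/
theorem negInv_mem_upperHalfPlaneSet {c : ℝ} (hc : 0 < c) {z : ℂ} (hz : z ∈ upperHalfPlaneSet) :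
    -((c : ℂ) * z)⁻¹ ∈ upperHalfPlaneSet := by
  have h : (c : ℂ) * z ∈ upperHalfPlaneSet := by
    show 0 < ((c : ℂ) * z).im
    have hz' : 0 < z.im := hz
    simpa [Complex.mul_im] using mul_pos hc hz'
  exact neg_inv_mem_upperHalfPlaneSet h

/-- `-1/(c z)` has nonnegative imaginary part when `z` has. -/
theorem negInv_im_nonneg {c : ℝ} (hc : 0 < c) {z : ℂ} (hz : 0 ≤ z.im) :
    0 ≤ (-((c : ℂ) * z)⁻¹).im := by
  rw [neg_im, inv_im, neg_div, neg_neg]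
  refine div_nonneg ?_ (Complex.normSq_nonneg _)
  simpa [Complex.mul_im] using mul_nonneg hc.le hz

/-- The inversion is an involution (on all of `ℂ`, thanks to `0⁻¹ = 0`), for `c ≠ 0`. -/
theorem negInv_negInv {c : ℝ} (hc : c ≠ 0) (z : ℂ) :
    -((c : ℂ) * -((c : ℂ) * z)⁻¹)⁻¹ = z := by
  have hc' : (c : ℂ) ≠ 0 := Complex.ofReal_ne_zero.2 hc
  rw [mul_neg, inv_neg, neg_neg, mul_inv, inv_inv, ← mul_assoc, inv_mul_cancel₀ hc', one_mul]

/-- `-1/(c z) ≠ 0` for `z ≠ 0`, `c ≠ 0`. -/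
theorem negInv_ne_zero {c : ℝ} (hc : c ≠ 0) {z : ℂ} (hz : z ≠ 0) : -((c : ℂ) * z)⁻¹ ≠ 0 := by
  have hc' : (c : ℂ) ≠ 0 := Complex.ofReal_ne_zero.2 hc
  simp [hc', hz]

/-- The modulus of `-1/(c z)` is `1/(c |z|)` (`c > 0`). -/
theorem norm_negInv {c : ℝ} (hc : 0 < c) (z : ℂ) : ‖-((c : ℂ) * z)⁻¹‖ = (c * ‖z‖)⁻¹ := by
  rw [norm_neg, norm_inv, norm_mul, Complex.norm_real, Real.norm_of_nonneg hc.le]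

/-- Dilations commute with the inversion up to inverting the factor: `ι (s w) = s⁻¹ ι w`. -/
theorem negInv_real_mul {c : ℝ} (s : ℝ) (w : ℂ) :
    -((c : ℂ) * ((s : ℂ) * w))⁻¹ = ((s⁻¹ : ℝ) : ℂ) * -((c : ℂ) * w)⁻¹ := by
  push_cast
  rw [show (c : ℂ) * ((s : ℂ) * w) = (s : ℂ) * ((c : ℂ) * w) by ring, mul_inv, mul_neg]

/-- `-1/(c z) → ∞` within `ℍ` as `z → 0` within `ℍ`. -/
theorem tendsto_negInv_zero {c : ℝ} (hc : 0 < c) :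
    Tendsto (fun z : ℂ => -((c : ℂ) * z)⁻¹) (𝓝[upperHalfPlaneSet] 0)
      (cocompact ℂ ⊓ 𝓟 upperHalfPlaneSet) := by
  refine tendsto_inf.2 ⟨?_, tendsto_principal.2 ?_⟩
  · rw [← Metric.cobounded_eq_cocompact, ← tendsto_norm_atTop_iff_cobounded]
    have h0 : Tendsto (fun z : ℂ => c * ‖z‖) (𝓝[upperHalfPlaneSet] 0) (𝓝[>] 0) := by
      refine tendsto_nhdsWithin_iff.2 ⟨?_, ?_⟩
      · have : Tendsto (fun z : ℂ => c * ‖z‖) (𝓝 0) (𝓝 (c * ‖(0 : ℂ)‖)) :=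
          (continuous_const.mul continuous_norm).tendsto 0
        rw [norm_zero, mul_zero] at this
        exact this.mono_left nhdsWithin_le_nhds
      · filter_upwards [self_mem_nhdsWithin] with z hz
        have hz' : 0 < z.im := hz
        have hz0 : z ≠ 0 := by rintro rfl; simp at hz'
        exact mul_pos hc (norm_pos_iff.2 hz0)
    refine (tendsto_inv_nhdsGT_zero.comp h0).congr fun z => ?_
    rw [Function.comp_apply, norm_negInv hc]
  · filter_upwards [self_mem_nhdsWithin] with z hz
    exact negInv_mem_upperHalfPlaneSet hc hz

/-- `-1/(c z) → 0` within `ℍ` as `z → ∞` within `ℍ`. -/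
theorem tendsto_negInv_cocompact {c : ℝ} (hc : 0 < c) :
    Tendsto (fun z : ℂ => -((c : ℂ) * z)⁻¹) (cocompact ℂ ⊓ 𝓟 upperHalfPlaneSet)
      (𝓝[upperHalfPlaneSet] 0) := by
  refine tendsto_nhdsWithin_iff.2 ⟨?_, ?_⟩
  · rw [← Metric.cobounded_eq_cocompact]
    have h1 : Tendsto (fun z : ℂ => ((c : ℂ) * z)⁻¹) (Bornology.cobounded ℂ) (𝓝 0) := by
      have hm : Tendsto (fun z : ℂ => (c : ℂ) * z) (Bornology.cobounded ℂ) (Bornology.cobounded ℂ) := by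
        rw [← tendsto_norm_atTop_iff_cobounded]
        have := (tendsto_norm_cobounded_atTop (E := ℂ)).const_mul_atTop hc
        refine this.congr fun z => ?_
        rw [norm_mul, Complex.norm_real, Real.norm_of_nonneg hc.le]
      exact Filter.tendsto_inv₀_cobounded.comp hm
    have h2 := h1.neg
    rw [neg_zero] at h2
    exact h2.mono_left inf_le_left
  · filter_upwards [mem_inf_of_right (mem_principal_self _)] with z hz
    exact negInv_mem_upperHalfPlaneSet hc hz

/-! ### The swapped uniformizer -/

variable {D : DobrushinDomain} {φ : ConformalEquiv upperHalfPlaneSet D.carrier}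
  {φ' : ConformalEquiv upperHalfPlaneSet D.swap.carrier}

/-- `φ ∘ ι` (`ι z = -1/z`) is a chordal uniformizer of the swapped domain `(D; b, a)`. -/
theorem isChordalUniformizing_invTrans (hφ : D.IsChordalUniformizing φ) :
    D.swap.IsChordalUniformizing (invEquivUpperHalfPlane.trans φ) := by
  refine ⟨?_, ?_⟩
  · show Tendsto (invEquivUpperHalfPlane.trans φ) (𝓝[upperHalfPlaneSet] 0) (𝓝 (D.swap.pt 0))
    rw [MarkedDomain.pt_swap_zero]
    refine (hφ.2.comp (tendsto_negInv_zero one_pos)).congr fun z => ?_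
    simp
  · show Tendsto (invEquivUpperHalfPlane.trans φ) (cocompact ℂ ⊓ 𝓟 upperHalfPlaneSet)
      (𝓝 (D.swap.pt 1))
    rw [MarkedDomain.pt_swap_one]
    refine (hφ.1.comp (tendsto_negInv_cocompact one_pos)).congr fun z => ?_
    simp

/-- **The two uniformizers differ by an inversion**: `φ' z = φ (-1/(c z))` on `ℍ` for some `c > 0`
(uniqueness of chordal uniformizers up to dilation, applied in `D.swap` to `φ'` and `φ ∘ ι`). -/
theorem exists_eqOn_swap (hφ : D.IsChordalUniformizing φ) (hφ' : D.swap.IsChordalUniformizing φ') :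
    ∃ c : ℝ, 0 < c ∧ ∀ z ∈ upperHalfPlaneSet, φ' z = φ (-((c : ℂ) * z)⁻¹) := by
  obtain ⟨c, hc, heq⟩ := MarkedDomain.IsChordalUniformizing.exists_eq_trans_smul_holds
    (isChordalUniformizing_invTrans hφ) hφ'
  refine ⟨c, hc, fun z hz => ?_⟩
  rw [heq hz]
  simp [Complex.real_smul]

/-! ### Boundary extensions -/

/-- `Φ' 0 = b` for a uniformizer of the swapped domain. -/
theorem bExt_swap_zero (hφ' : D.swap.IsChordalUniformizing φ') : φ'.boundaryExtension 0 = D.pt 1 := by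
  rw [hφ'.boundaryExtension_zero, MarkedDomain.pt_swap_zero]

/-- **The boundary extensions differ by the inversion**: `Φ' z = Φ (-1/(c z))` for `z ∈ ℍ̄`, `z ≠ 0`,
whenever `φ' = φ ∘ ι_c` on `ℍ`. -/
theorem bExt_swap_eq {c : ℝ} (hc : 0 < c)
    (heq : ∀ z ∈ upperHalfPlaneSet, φ' z = φ (-((c : ℂ) * z)⁻¹)) {z : ℂ} (hz : 0 ≤ z.im)
    (hz0 : z ≠ 0) : φ'.boundaryExtension z = φ.boundaryExtension (-((c : ℂ) * z)⁻¹) := by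
  have hzc : z ∈ closure upperHalfPlaneSet := mem_closure_upperHalfPlaneSet_iff.2 hz
  refine φ'.boundaryExtension_eq_of_hasBoundaryValue hzc ?_
  -- `φ' = φ ∘ ι` on `ℍ`, `ι` is continuous at `z ≠ 0` and preserves `ℍ`, `Φ` is continuous on `ℍ̄`
  have hι : ContinuousAt (fun w : ℂ => -((c : ℂ) * w)⁻¹) z := by
    have h1 : ContinuousAt (fun w : ℂ => (c : ℂ) * w) z := (continuous_const.mul continuous_id).continuousAt
    exact (h1.inv₀ (mul_ne_zero (Complex.ofReal_ne_zero.2 hc.ne') hz0)).neg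
  have hιw : Tendsto (fun w : ℂ => -((c : ℂ) * w)⁻¹) (𝓝[upperHalfPlaneSet] z)
      (𝓝[upperHalfPlaneSet] (-((c : ℂ) * z)⁻¹)) :=
    tendsto_nhdsWithin_iff.2 ⟨hι.tendsto.mono_left nhdsWithin_le_nhds,
      eventually_nhdsWithin_of_forall fun w hw => negInv_mem_upperHalfPlaneSet hc hw⟩
  have hΦ : Tendsto φ.boundaryExtension (𝓝[upperHalfPlaneSet] (-((c : ℂ) * z)⁻¹))
      (𝓝 (φ.boundaryExtension (-((c : ℂ) * z)⁻¹))) := by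
    have h := (continuousOn_boundaryExtension_im_nonneg φ) _ (negInv_im_nonneg hc hz)
    exact h.tendsto.mono_left (nhdsWithin_mono _ fun w (hw : 0 < w.im) => hw.le)
  have hΦ' : Tendsto (fun w => φ (-((c : ℂ) * w)⁻¹)) (𝓝[upperHalfPlaneSet] z)
      (𝓝 (φ.boundaryExtension (-((c : ℂ) * z)⁻¹))) := by
    refine (hΦ.comp hιw).congr' ?_
    filter_upwards [self_mem_nhdsWithin] with w hw
    exact φ.boundaryExtension_eq (negInv_mem_upperHalfPlaneSet hc hw)
  refine hΦ'.congr' ?_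
  filter_upwards [self_mem_nhdsWithin] with w hw
  exact (heq w hw).symm

/-! ### The inverse `ψ = invFunOn Φ ℍ̄` -/

/-- `ψ' b = 0` for a uniformizer of the swapped domain. -/
theorem invFunOn_bExt_swap_pt_one (hφ' : D.swap.IsChordalUniformizing φ') :
    invFunOn φ'.boundaryExtension {z : ℂ | 0 ≤ z.im} (D.pt 1) = 0 := by
  rw [← MarkedDomain.pt_swap_zero]
  exact FaithfulAttach.invFun_pt_zero hφ'

/-- `ψ w ≠ 0` for `w ≠ a` in `closure D ∖ {b}`. -/
theorem invFunOn_bExt_ne_zero (hφ : D.IsChordalUniformizing φ) {w : ℂ} (hw : w ∈ closure D.carrier)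
    (hwb : w ≠ D.pt 1) (hwa : w ≠ D.pt 0) :
    invFunOn φ.boundaryExtension {z : ℂ | 0 ≤ z.im} w ≠ 0 := by
  intro h
  exact hwa ((FaithfulAttach.invFun_eq_zero_iff hφ hw hwb).1 h)

/-- **The two inverses differ by the inversion**: `ψ' w = -1/(c ψ w)` on `closure D ∖ {a, b}`. -/
theorem invFunOn_bExt_swap_eq (hφ : D.IsChordalUniformizing φ) {c : ℝ} (hc : 0 < c)
    (heq : ∀ z ∈ upperHalfPlaneSet, φ' z = φ (-((c : ℂ) * z)⁻¹)) {w : ℂ} (hw : w ∈ closure D.carrier)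
    (hwa : w ≠ D.pt 0) (hwb : w ≠ D.pt 1) :
    invFunOn φ'.boundaryExtension {z : ℂ | 0 ≤ z.im} w =
      -((c : ℂ) * invFunOn φ.boundaryExtension {z : ℂ | 0 ≤ z.im} w)⁻¹ := by
  set z := invFunOn φ.boundaryExtension {z : ℂ | 0 ≤ z.im} w with hz_def
  have hz : 0 ≤ z.im ∧ φ.boundaryExtension z = w := FaithfulAttach.invFun_spec hφ hw hwb
  have hz0 : z ≠ 0 := invFunOn_bExt_ne_zero hφ hw hwb hwa
  have him : 0 ≤ (-((c : ℂ) * z)⁻¹).im := negInv_im_nonneg hc hz.1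
  have hval : φ'.boundaryExtension (-((c : ℂ) * z)⁻¹) = w := by
    rw [bExt_swap_eq hc heq him (negInv_ne_zero hc.ne' hz0), negInv_negInv hc.ne', hz.2]
  have hinj : InjOn φ'.boundaryExtension {z : ℂ | 0 ≤ z.im} := FaithfulAttach.bext_injOn (D := D.swap) φ'
  rw [← hval]
  exact hinj.leftInvOn_invFunOn him

end Summit.CriticalPhenomena.SAWScalingLimit.Theorems.AttachReversal

end
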